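import Summits.Ventures.HodgeRepro2.T5SU11KernelTwoSidedBound
import Summits.Ventures.HodgeRepro2.T5SU11KernelTaylor
import Summits.Ventures.HodgeRepro2.T5SU11ResolventIterateHilbert
import Summits.Ventures.HodgeRepro2.T5SU11KernelCompositionSymmetric

/-!
# The kernel as a function of the spectral parameter, uniformly in `(t, s)` away from the corner: the composed kernels,
the Lipschitz bound, the second-order Taylor remainder, and continuity in `λ` in the sup-norm

With row 600's uniform `W_1` constant `C Ξ(s)` of the kernel sources `K_{λ₂}(·, s)`, `s ≥ a`, the pointwise-in-`s` statements of
rows 557, 5xx and 578 become uniform in `(t, s) ∈ (0, ∞) × [a, ∞)` (and on `{max(t, s) ≥ a}` by symmetry):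

* `exists_kernel_comp_le_uniform`, `exists_kernel_comp_le_uniform_of_le_max` — **`|K_λ^{∘(n+1)}(t, s)| ≤ C Ξ(s) Ξ(t)/((λ − 1)²)ⁿ`**;
* `exists_abs_kernel_sub_le_uniform`, `exists_abs_kernel_sub_le_uniform_of_le_max` — **the kernel is Lipschitz in `μ` in the
  `Ξ ⊗ Ξ`-weighted sup-norm: `|K_λ(t, s) − K_{λ₂}(t, s)| ≤ |μ − μ₂| C Ξ(s) Ξ(t)/(λ − 1)²`**, `C = C(λ₂, a)` for EVERY `λ > 1`;
* `exists_abs_kernel_sub_sub_le_uniform` — **the second-order remainder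
  `|K_λ − K_{λ₂} − (μ − μ₂) K_{λ₂} ∘ K_{λ₂}|(t, s) ≤ (μ − μ₂)² C Ξ(s) Ξ(t)/((λ − 1)²(λ₂ − 1)²)`**;
* `tendstoUniformlyOn_kernel_nhds` — **`λ ↦ K_λ(t, s)` is continuous at every `λ₂ > 1` uniformly in `(t, s)` on
  `{max(t, s) ≥ a}`**.

The corner `t, s → 0` is excluded for the reason recorded in row 600 (the logarithmic singularity of the kernel).
Nothing is claimed about (N).

Blind lane: Mathlib + the HodgeRepro2 prefix only; no sorry; axioms ⊆ {propext, Classical.choice,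
Quot.sound}.
-/

namespace Summit.Ventures.HodgeRepro2.T5SU11KernelUniformBounds

open Filter Topology MeasureTheory
open Set (Ioi Ioc)
open T5SU11Cartan T5SU11SphericalFunction T5SU11SphericalBounds T5SU11SphericalDecay T5SU11RadialGreenKernel
  T5SU11RadialGreenImproper T5SU11KernelDifferenceRegularity T5SU11ResolventGroundStateWeight
  T5SU11WeightedSpaceGroundState T5SU11KernelTaylor T5SU11KernelTwoSidedBound T5SU11ResolventIterateHilbert
  T5SU11KernelCompositionSymmetric

section measure

variable [MeasurableSpace Circle] [BorelSpace Circle]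

variable {lam₂ : ℝ} (hlam₂ : 1 < lam₂)

include hlam₂ in
/-- **The composed kernels, uniformly in `(t, s)` with `s ≥ a`**: `|K_λ^{∘(n+1)}(t, s)| ≤ C Ξ(s) Ξ(t)/((λ − 1)²)ⁿ`. -/
theorem exists_kernel_comp_le_uniform {a : ℝ} (ha : 0 < a) :
    ∃ C : ℝ, 0 < C ∧ ∀ n : ℕ, ∀ t s, 0 < t → a ≤ s →
      |((greenSolI (fun t => sph lam₂ (hyp t)) (sphDecay lam₂))^[n] (fun r => sphGreenKernel lam₂ r s)) t|
        ≤ C * sph 1 (hyp s) * sph 1 (hyp t) / ((lam₂ - 1) ^ 2) ^ n := by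
  obtain ⟨C, hC, hC'⟩ := exists_kernel_source_le_mul_sph_one_uniform hlam₂ ha
  refine ⟨C, hC, fun n t s ht hs => ?_⟩
  have hs0 : 0 < s := lt_of_lt_of_le ha hs
  have hg := kernel_source_continuousOn hlam₂ hs0
  exact (iterate_mem_weighted_one hlam₂ hg (hC' s hs) n).2 t ht

include hlam₂ in
/-- The composed kernels on the region `max(t, s) ≥ a` (symmetry of the composed kernels, row 582). -/
theorem exists_kernel_comp_le_uniform_of_le_max {a : ℝ} (ha : 0 < a) :
    ∃ C : ℝ, 0 < C ∧ ∀ n : ℕ, ∀ t s, 0 < t → 0 < s → a ≤ max t s →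
      |((greenSolI (fun t => sph lam₂ (hyp t)) (sphDecay lam₂))^[n] (fun r => sphGreenKernel lam₂ r s)) t|
        ≤ C * sph 1 (hyp s) * sph 1 (hyp t) / ((lam₂ - 1) ^ 2) ^ n := by
  obtain ⟨C, hC, hC'⟩ := exists_kernel_comp_le_uniform hlam₂ ha
  refine ⟨C, hC, fun n t s ht hs hm => ?_⟩
  rcases le_total t s with hts | hst
  · rw [max_eq_right hts] at hm
    exact hC' n t s ht hm
  · rw [max_eq_left hst] at hm
    rw [kernel_comp_symm hlam₂ n ht hs, mul_right_comm C (sph 1 (hyp s))]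
    exact hC' n s t hs hm

include hlam₂ in
/-- **THE KERNEL IS LIPSCHITZ IN `μ` UNIFORMLY IN `(t, s)` AWAY FROM THE CORNER**: there is `C = C(λ₂, a) > 0` with
`|K_λ(t, s) − K_{λ₂}(t, s)| ≤ |μ − μ₂| · C Ξ(s) Ξ(t)/(λ − 1)²` for every `λ > 1`, `t > 0`, `s ≥ a`. -/
theorem exists_abs_kernel_sub_le_uniform {a : ℝ} (ha : 0 < a) :
    ∃ C : ℝ, 0 < C ∧ ∀ lam, 1 < lam → ∀ t s, 0 < t → a ≤ s →
      |sphGreenKernel lam t s - sphGreenKernel lam₂ t s|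
        ≤ |lam * (lam - 2) - lam₂ * (lam₂ - 2)| * (C * sph 1 (hyp s) * sph 1 (hyp t) / (lam - 1) ^ 2) := by
  obtain ⟨C, hC, hC'⟩ := exists_kernel_source_le_mul_sph_one_uniform hlam₂ ha
  refine ⟨C, hC, fun lam hlam t s ht hs => ?_⟩
  have hs0 : 0 < s := lt_of_lt_of_le ha hs
  have hg := kernel_source_continuousOn hlam₂ hs0
  rw [kernel_sub_kernel_eq_greenSolI hlam hlam₂ hs0 ht, abs_mul]
  exact mul_le_mul_of_nonneg_left (abs_greenSolI_le_mul_sph_one' hlam hg (hC' s hs) ht) (abs_nonneg _)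

include hlam₂ in
/-- The Lipschitz bound on the region `max(t, s) ≥ a` (symmetry of the kernel). -/
theorem exists_abs_kernel_sub_le_uniform_of_le_max {a : ℝ} (ha : 0 < a) :
    ∃ C : ℝ, 0 < C ∧ ∀ lam, 1 < lam → ∀ t s, 0 < t → 0 < s → a ≤ max t s →
      |sphGreenKernel lam t s - sphGreenKernel lam₂ t s|
        ≤ |lam * (lam - 2) - lam₂ * (lam₂ - 2)| * (C * sph 1 (hyp s) * sph 1 (hyp t) / (lam - 1) ^ 2) := by
  obtain ⟨C, hC, hC'⟩ := exists_abs_kernel_sub_le_uniform hlam₂ ha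
  refine ⟨C, hC, fun lam hlam t s ht hs hm => ?_⟩
  rcases le_total t s with hts | hst
  · rw [max_eq_right hts] at hm
    exact hC' lam hlam t s ht hm
  · rw [max_eq_left hst] at hm
    rw [sphGreenKernel_symm lam t s, sphGreenKernel_symm lam₂ t s, mul_right_comm C (sph 1 (hyp s))]
    exact hC' lam hlam s t hs hm

include hlam₂ in
/-- **The second-order Taylor remainder of the kernel, uniformly in `(t, s)` with `s ≥ a`**:
`|K_λ(t, s) − K_{λ₂}(t, s) − (μ − μ₂) (K_{λ₂} ∘ K_{λ₂})(t, s)| ≤ (μ − μ₂)² C Ξ(s) Ξ(t)/((λ − 1)² (λ₂ − 1)²)` for every `λ > 1`. -/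
theorem exists_abs_kernel_sub_sub_le_uniform {a : ℝ} (ha : 0 < a) :
    ∃ C : ℝ, 0 < C ∧ ∀ lam, 1 < lam → ∀ t s, 0 < t → a ≤ s →
      |sphGreenKernel lam t s - sphGreenKernel lam₂ t s
        - (lam * (lam - 2) - lam₂ * (lam₂ - 2))
          * ∫ r in Ioi 0, sphGreenKernel lam₂ t r * sphGreenKernel lam₂ r s * Real.sinh (2 * r)|
      ≤ (lam * (lam - 2) - lam₂ * (lam₂ - 2)) ^ 2 * (C * sph 1 (hyp s) * sph 1 (hyp t))
          / ((lam - 1) ^ 2 * (lam₂ - 1) ^ 2) := by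
  obtain ⟨C, hC, hC'⟩ := exists_kernel_source_le_mul_sph_one_uniform hlam₂ ha
  refine ⟨C, hC, fun lam hlam t s ht hs => ?_⟩
  have hs0 : 0 < s := lt_of_lt_of_le ha hs
  have hg := kernel_source_continuousOn hlam₂ hs0
  rw [kernel_sub_sub_eq hlam hlam₂ hs0 ht, abs_mul, abs_pow, sq_abs]
  obtain ⟨hcont₂, hbound₂⟩ := greenSolI_mem_weighted_one hlam₂ hg (hC' s hs)
  have hstep := abs_greenSolI_le_mul_sph_one' hlam hcont₂ hbound₂ ht
  have hp1 : 0 < (lam - 1) ^ 2 := by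
    have : 0 < lam - 1 := by linarith
    positivity
  have hp2 : 0 < (lam₂ - 1) ^ 2 := by
    have : 0 < lam₂ - 1 := by linarith
    positivity
  calc (lam * (lam - 2) - lam₂ * (lam₂ - 2)) ^ 2
        * |greenSolI (fun t => sph lam (hyp t)) (sphDecay lam)
          (greenSolI (fun t => sph lam₂ (hyp t)) (sphDecay lam₂) (fun r => sphGreenKernel lam₂ r s)) t|
      ≤ (lam * (lam - 2) - lam₂ * (lam₂ - 2)) ^ 2
          * (C * sph 1 (hyp s) / (lam₂ - 1) ^ 2 * sph 1 (hyp t) / (lam - 1) ^ 2) :=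
        mul_le_mul_of_nonneg_left hstep (sq_nonneg _)
    _ = (lam * (lam - 2) - lam₂ * (lam₂ - 2)) ^ 2 * (C * sph 1 (hyp s) * sph 1 (hyp t))
          / ((lam - 1) ^ 2 * (lam₂ - 1) ^ 2) := by
        field_simp

include hlam₂ in
/-- **`λ ↦ K_λ(t, s)` IS CONTINUOUS AT `λ₂` UNIFORMLY IN `(t, s)` ON `{max(t, s) ≥ a}`**: the kernels `K_λ` converge to `K_{λ₂}` in the
sup-norm on that region as `λ → λ₂`. -/
theorem tendstoUniformlyOn_kernel_nhds {a : ℝ} (ha : 0 < a) :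
    TendstoUniformlyOn (fun lam (p : ℝ × ℝ) => sphGreenKernel lam p.1 p.2) (fun p => sphGreenKernel lam₂ p.1 p.2)
      (𝓝 lam₂) {p : ℝ × ℝ | 0 < p.1 ∧ 0 < p.2 ∧ a ≤ max p.1 p.2} := by
  obtain ⟨C, hC, hC'⟩ := exists_abs_kernel_sub_le_uniform_of_le_max hlam₂ ha
  rw [Metric.tendstoUniformlyOn_iff]
  intro ε hε
  -- the bound `|μ − μ₂| C/(λ − 1)²` tends to `0` as `λ → λ₂`
  have h1 : Tendsto (fun lam : ℝ => |lam * (lam - 2) - lam₂ * (lam₂ - 2)|) (𝓝 lam₂) (𝓝 0) := by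
    have h : Tendsto (fun lam : ℝ => lam * (lam - 2) - lam₂ * (lam₂ - 2)) (𝓝 lam₂)
        (𝓝 (lam₂ * (lam₂ - 2) - lam₂ * (lam₂ - 2))) :=
      ((continuous_id.mul (continuous_id.sub continuous_const)).sub continuous_const).tendsto lam₂
    rw [sub_self] at h
    simpa using h.abs
  have h2 : Tendsto (fun lam : ℝ => C / (lam - 1) ^ 2) (𝓝 lam₂) (𝓝 (C / (lam₂ - 1) ^ 2)) := by
    have hne : (lam₂ - 1) ^ 2 ≠ 0 := by
      have : 0 < lam₂ - 1 := by linarith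
      positivity
    exact tendsto_const_nhds.div (((continuous_id.sub continuous_const).pow 2).tendsto lam₂) hne
  have hB : Tendsto (fun lam : ℝ => |lam * (lam - 2) - lam₂ * (lam₂ - 2)| * (C / (lam - 1) ^ 2)) (𝓝 lam₂) (𝓝 0) := by
    simpa using h1.mul h2
  have hev := (tendsto_order.1 hB).2 ε hε
  filter_upwards [hev, lt_mem_nhds hlam₂] with lam hlam' hlam1
  rintro ⟨t, s⟩ ⟨ht, hs, hm⟩
  rw [Real.dist_eq, abs_sub_comm]
  refine lt_of_le_of_lt ?_ hlam'
  have hΞt : sph 1 (hyp t) ≤ 1 := sph_hyp_le_one zero_le_one one_le_two t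
  have hΞs : sph 1 (hyp s) ≤ 1 := sph_hyp_le_one zero_le_one one_le_two s
  have hΞt0 : 0 < sph 1 (hyp t) := sph_hyp_pos 1 t
  have hL : 0 < (lam - 1) ^ 2 := by
    have : 0 < lam - 1 := by linarith
    positivity
  calc |sphGreenKernel lam t s - sphGreenKernel lam₂ t s|
      ≤ |lam * (lam - 2) - lam₂ * (lam₂ - 2)| * (C * sph 1 (hyp s) * sph 1 (hyp t) / (lam - 1) ^ 2) :=
        hC' lam hlam1 t s ht hs hm
    _ ≤ |lam * (lam - 2) - lam₂ * (lam₂ - 2)| * (C * 1 * 1 / (lam - 1) ^ 2) := by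
        apply mul_le_mul_of_nonneg_left _ (abs_nonneg _)
        apply div_le_div_of_nonneg_right _ hL.le
        exact mul_le_mul (mul_le_mul_of_nonneg_left hΞs hC.le) hΞt hΞt0.le (by positivity)
    _ = |lam * (lam - 2) - lam₂ * (lam₂ - 2)| * (C / (lam - 1) ^ 2) := by ring

end measure

end Summit.Ventures.HodgeRepro2.T5SU11KernelUniformBounds
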